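import HarnessLib
import Summits.PneNP.PneNP.Statement
import Summits.PneNP.PneNP.Theorems.SoloBlindAnchor
import Summits.PneNP.PneNP.Theorems.SzkEntropyPhCollapseStandalone
import Literature.Computability.MetaComplexity.LevinKt
import Literature.Computability.MetaComplexity.UniversalMachineProofs
import Literature.Computability.Complexity.CircuitClasses
import Literature.Computability.Complexity.CircuitSizeProofs
import Literature.Computability.Complexity.CircuitClassesProofs
import Literature.Computability.Complexity.CircuitClassesUniformProofs
import Literature.Computability.Complexity.WorstCaseToMild
import Literature.Computability.Complexity.ExpTimeCollapsesProofs
import Literature.Computability.Complexity.PolyHierarchy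
import Literature.Computability.Complexity.NSubexp
import Literature.Computability.Complexity.TimeHierarchyProofs

/-!
# The PEREBOR LAW construction for `RootDecompKtPerebor` (helper for stmt-PneNP-29375 `PereborLawTwo`) — part A

Node N16 of the decomp-pnenp root-decomposition cell (route `route-PneNP-RootDecompKtPerebor`, lens-3 g5
«KtPereborDial») cuts the root along the perebor-exponent dial of Levin's `Kt`.  Its engine is the
PEREBOR LAW «`W_U ∈ SIZE(n^K·polylog)` ⟹ `Kt`-perebor is beaten to exponent `K/(K+1)` on `U`», where
`W_U` is the clocked-witness language (⟨x,⟨1^σ,1^τ⟩⟩ : some program `p` with `|p| + ⌈log t⌉ ≤ σ` prints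
`x` within `t ≤ τ` steps).  THIS FILE (part A) ports verbatim from the lens kernel
(HOME/decomp-pnenp-lens-3/KtPereborDial.lean sha256 844e006f…, critic CLEARED 06:14:40Z) the CONSTRUCTION at
one input length: the semantic split of `MKtP_U[s]` into a TABLE part (witness programs of length `≤ γ`,
fewer than `2^{γ+1}` strings per length) and a PADDED QUERY to `W_U` (`mem_MKtP_iff_table_or_W`,
`ncard_table_lt`), the padded query as a projection-with-constants (`cktSize_padVec`, 2 gates), the table
as an OR of equality tests (`Table.cktSize_table`), and the per-length bound
`circuitSize_MKtP_le_of_W : size(MKtP_U[s] ∩ {0,1}^N) ≤ 2^{γ+1}(2N+2) + 4 + size_W(padLen (s N) γ N)`.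
Part B (`RootDecompKtPereborPereborLawTwo.lean`) adds the arithmetic and the law for every `K`, and lands
the route item at `K = 2`.  The definitions here (`pereborBound`, `W`, `padTail`, `padQ`, `padLen`, `padVec`,
`Table.orFin`) are the construction's DATA (values in ℕ, List Bool and Language Bool; the route item inlines `W` and
the perebor bound verbatim) — no `Prop`-valued statement is introduced (the lens's `KtEasy` / `FixedPolylogSize` /
`PereborLaw` / `TablePred` are unfolded in place).  0 sorry.
[cite: HiraharaIlangoWilliams2024] [cite: AroraBarak2009]
-/

namespace Summit.PneNP.PneNP.Theorems.RootDecompKtPereborPort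

open _root_.Computability Literature.Computability.Complexity Literature.Computability.MetaComplexity
open Filter Topology Nondeterministic
open Summit.PneNP.PneNP.Theorems

/-! ## The dial: perebor exponent of Levin's `Kt` -/

/-- The perebor size bound at exponent `α` for threshold `s` with slack `c`:
`N ↦ c · 2^{⌈α·s(N)⌉} · N^c + c` ("a `2^{α s}`-fraction of exhaustive search, times `poly(N)`"). -/
noncomputable def pereborBound (α : ℝ) (s : ℕ → ℕ) (c : ℕ) : ℕ → ℕ :=
  fun N => c * 2 ^ ⌈α * (s N : ℝ)⌉₊ * N ^ c + c

/-! ## The engine: the PEREBOR LAW (typed here; KERNEL-PROVED for every `K` at the end of the file) -/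

/-- The witness language `W_U`: `⟨x, ⟨a, b⟩⟩ ∈ W_U` iff some program `p` prints `x` within `t ≤ |b|`
steps with `|p| + ⌈log₂ t⌉ ≤ |a|` (threshold and time budget passed in UNARY as the lengths of `a`, `b`).
`W_U ∈ NP` (guess `p`, run the efficient universal machine for `t ≤ |input|` steps). -/
def W (U : UniversalMachine) : Language Bool :=
  {w | ∃ (p : List Bool) (t : ℕ), t ≤ (boolUnpair (boolUnpair w).2).2.length ∧
      U.run p t = some (boolUnpair w).1 ∧
      p.length + Nat.clog 2 t ≤ (boolUnpair (boolUnpair w).2).1.length}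

/-- KERNEL (semantic half of the law): membership in `MKtP_U[s]` splits into a TABLE part (witness
program of length `≤ γ`: at most `2^{γ+1}` strings per length, `run_output_unique`) and a PADDED
QUERY to `W_U` with time budget `2^{s(N)-γ-1}` (longer programs leave `⌈log t⌉ ≤ s - γ - 1`). -/
theorem mem_MKtP_iff_table_or_W (U : UniversalMachine) (s : ℕ → ℕ) (γ : ℕ) (x a b : List Bool)
    (ha : a.length = s x.length) (hb : b.length = 2 ^ (s x.length - γ - 1)) :
    x ∈ U.MKtP s ↔
      (∃ (p : List Bool) (t : ℕ), p.length ≤ γ ∧ U.run p t = some x ∧ p.length + Nat.clog 2 t ≤ s x.length) ∨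
      boolPair x (boolPair a b) ∈ W U := by
  have key : x ∈ U.MKtP s ↔ ∃ (p : List Bool) (t : ℕ), U.run p t = some x ∧ p.length + Nat.clog 2 t ≤ s x.length :=
    U.levinKt_le_coe_iff
  rw [key]
  constructor
  · rintro ⟨p, t, hrun, hle⟩
    by_cases hp : p.length ≤ γ
    · exact Or.inl ⟨p, t, hp, hrun, hle⟩
    · refine Or.inr ⟨p, t, ?_, ?_, ?_⟩
      · simp only [boolUnpair_boolPair, hb]
        have hclog : Nat.clog 2 t ≤ s x.length - γ - 1 := by omega
        exact (Nat.clog_le_iff_le_pow (by norm_num)).1 hclog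
      · simpa only [boolUnpair_boolPair] using hrun
      · simpa only [boolUnpair_boolPair, ha] using hle
  · rintro (⟨p, t, -, hrun, hle⟩ | ⟨p, t, -, hrun, hle⟩)
    · exact ⟨p, t, hrun, hle⟩
    · refine ⟨p, t, ?_, ?_⟩
      · simpa only [boolUnpair_boolPair] using hrun
      · simpa only [boolUnpair_boolPair, ha] using hle

/-- KERNEL (table half, counting): the table part at length `N` has fewer than `2^{γ+1}` members —
each member is printed by a program of length `≤ γ`, there are `2^{γ+1} - 1` of those, and a program
prints at most one string (`run_output_unique`). This is the `2^γ` TABLE COST in the law. -/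
theorem ncard_table_lt (U : UniversalMachine) (s : ℕ → ℕ) (γ N : ℕ) :
    {x : List Bool | x.length = N ∧ ∃ (p : List Bool) (t : ℕ), p.length ≤ γ ∧ U.run p t = some x ∧
      p.length + Nat.clog 2 t ≤ s x.length}.ncard < 2 ^ (γ + 1) := by
  set S : Set (List Bool) := {x : List Bool | x.length = N ∧ ∃ (p : List Bool) (t : ℕ), p.length ≤ γ ∧
      U.run p t = some x ∧ p.length + Nat.clog 2 t ≤ s x.length}
  have hS : ∀ x : S, ∃ prog, (∃ t, U.run prog t = some x.1) ∧ prog.length < γ + 1 := fun x => by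
    obtain ⟨-, prog, t, h1, h2, -⟩ := x.2
    exact ⟨prog, ⟨t, h2⟩, by omega⟩
  choose f hf hfl using hS
  let g : S → Σ k : Fin (γ + 1), List.Vector Bool k := fun x => ⟨⟨(f x).length, hfl x⟩, ⟨f x, rfl⟩⟩
  have hg : Function.Injective g := by
    intro x x' h
    have h' : f x = f x' :=
      congr_arg (fun s : Σ k : Fin (γ + 1), List.Vector Bool k => s.2.toList) h
    obtain ⟨t, ht⟩ := hf x
    obtain ⟨t', ht'⟩ := hf x'
    rw [h'] at ht
    exact Subtype.ext (U.run_output_unique ht ht')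
  calc S.ncard = Nat.card S := (Nat.card_coe_set_eq S).symm
    _ ≤ Nat.card (Σ k : Fin (γ + 1), List.Vector Bool k) := Nat.card_le_card_of_injective g hg
    _ = ∑ k ∈ Finset.range (γ + 1), 2 ^ k := by
      rw [Nat.card_eq_fintype_card, Fintype.card_sigma]
      simp only [card_vector, Fintype.card_bool]
      exact Fin.sum_univ_eq_sum_range (fun k => 2 ^ k) (γ + 1)
    _ < 2 ^ (γ + 1) := Nat.geomSum_lt le_rfl fun k hk => Finset.mem_range.mp hk

/-! ## The PEREBOR LAW in KERNEL, part 1: the padded query as a projection-with-constants -/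

/-- The constant tail of the padded query: separator `01`, then `⟨1^σ, 1^{2^{σ-γ-1}}⟩`. -/
def padTail (σ γ : ℕ) : List Bool :=
  [false, true] ++ boolPair (List.replicate σ true) (List.replicate (2 ^ (σ - γ - 1)) true)

/-- The padded query `⟨x, ⟨1^σ, 1^{2^{σ-γ-1}}⟩⟩`. -/
def padQ (σ γ : ℕ) (x : List Bool) : List Bool :=
  boolPair x (boolPair (List.replicate σ true) (List.replicate (2 ^ (σ - γ - 1)) true))

/-- `padQ` in closed form (the interleaving followed by the tail). -/
theorem padQ_eq (σ γ : ℕ) (x : List Bool) :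
    padQ σ γ x = (x.flatMap fun b => [b, b]) ++ padTail σ γ := by
  simp [padQ, padTail, boolPair, List.append_assoc]

/-- Length of the padded query: `m = 2|x| + 2 + (2σ + 2 + 2^{σ-γ-1})`. -/
theorem length_padTail (σ γ : ℕ) : (padTail σ γ).length = 2 + (2 * σ + 2 + 2 ^ (σ - γ - 1)) := by
  simp [padTail, length_boolPair]; omega

/-- Length of the padded query. -/
theorem length_padQ (σ γ : ℕ) (x : List Bool) :
    (padQ σ γ x).length = 2 * x.length + 2 + (2 * σ + 2 + 2 ^ (σ - γ - 1)) := by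
  rw [padQ_eq, List.length_append, length_flatMap_dup, length_padTail]; omega

/-- Indexing the doubled string: position `i` holds bit `i / 2`. -/
theorem getElem?_flatMap_dup (x : List Bool) (i : ℕ) : (x.flatMap fun b => [b, b])[i]? = x[i / 2]? := by
  induction x generalizing i with
  | nil => simp
  | cons b l ih =>
    rw [List.flatMap_cons]
    match i with
    | 0 => simp
    | 1 => simp
    | j + 2 =>
      have h2 : ([b, b] ++ List.flatMap (fun b => [b, b]) l)[j + 2]? = (List.flatMap (fun b => [b, b]) l)[j]? := by
        rw [List.getElem?_append_right (by simp)]; simp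
      rw [h2, ih j]
      have e : (j + 2) / 2 = j / 2 + 1 := by omega
      rw [e, List.getElem?_cons_succ]

/-- The query length as a function of `N = |x|`. -/
def padLen (σ γ N : ℕ) : ℕ := 2 * N + 2 + (2 * σ + 2 + 2 ^ (σ - γ - 1))

/-- Coordinate `i` of the padded query as a function of the input bits `z : Fin N → Bool`:
a copy of an input bit (positions `< 2N`) or a constant. -/
def padVec (σ γ N : ℕ) (z : Fin N → Bool) (i : Fin (padLen σ γ N)) : Bool :=
  if h : (i : ℕ) < 2 * N then z ⟨i / 2, by omega⟩ else ((padTail σ γ)[(i : ℕ) - 2 * N]?).getD false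

/-- The projection `padVec` realises the padded query `padQ` on length-`N` inputs. -/
theorem ofFn_padVec (σ γ N : ℕ) (z : Fin N → Bool) :
    List.ofFn (padVec σ γ N z) = padQ σ γ (List.ofFn z) := by
  apply List.ext_getElem?
  intro i
  rw [List.getElem?_ofFn, padQ_eq]
  by_cases hi : i < padLen σ γ N
  · simp only [hi, ↓reduceDIte]
    by_cases h2 : i < 2 * N
    · rw [List.getElem?_append_left (by rw [length_flatMap_dup, List.length_ofFn]; exact h2),
        getElem?_flatMap_dup, List.getElem?_ofFn]
      have : i / 2 < N := by omega
      simp [padVec, h2, this]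
    · rw [List.getElem?_append_right (by rw [length_flatMap_dup, List.length_ofFn]; omega),
        length_flatMap_dup, List.length_ofFn]
      have hlt : i - 2 * N < (padTail σ γ).length := by
        rw [length_padTail]; unfold padLen at hi; omega
      simp only [padVec, h2, ↓reduceDIte]
      rw [List.getElem?_eq_getElem hlt]
      rfl
  · simp only [hi, ↓reduceDIte]
    symm
    rw [List.getElem?_eq_none_iff]
    rw [List.length_append, length_flatMap_dup, List.length_ofFn, length_padTail]
    unfold padLen at hi; omega

/-- The projection-with-constants `z ↦ padVec z` costs two gates over `B₂` (one constant `1`, one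
constant `0`; copies of input bits are free). -/
theorem cktSize_padVec (σ γ N : ℕ) : CktSize B2 (fun (z : Fin N → Bool) => padVec σ γ N z) 2 := by
  have h : CktSize B2 (fun (z : Fin N → Bool) =>
      Sum.elim z (Sum.elim (fun (_ : Unit) => true) (fun (_ : Unit) => false))) (0 + (1 + 1)) :=
    (CktSize.id B2).pair ((cktSize_const (Fin N) true).pair (cktSize_const (Fin N) false))
  refine (h.outMap (fun i : Fin (padLen σ γ N) =>
    if hi : (i : ℕ) < 2 * N then (Sum.inl ⟨i / 2, by omega⟩ : Fin N ⊕ (Unit ⊕ Unit))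
    else if ((padTail σ γ)[(i : ℕ) - 2 * N]?).getD false then Sum.inr (Sum.inl ())
    else Sum.inr (Sum.inr ()))).congr ?_
  intro z i
  unfold padVec
  by_cases hi : (i : ℕ) < 2 * N
  · simp [hi]
  · simp only [hi, ↓reduceDIte]
    cases ((padTail σ γ)[(i : ℕ) - 2 * N]?).getD false <;> simp


/-! ## The TABLE (OR of equality tests), from the lens §«Decided end α = 1» -/

namespace Table

open SelfCorrect

/-- Iterated OR of `m` bits, as a chain. [folklore] -/
def orFin : (m : ℕ) → (Fin m → Bool) → Bool
  | 0, _ => false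
  | m + 1, z => orFin m (fun j => z j.castSucc) || z (Fin.last m)

/-- `orFin` computes the disjunction. -/
theorem orFin_eq_decide : ∀ (m : ℕ) (z : Fin m → Bool), orFin m z = decide (∃ j, z j = true)
  | 0, z => by simp [orFin]
  | m + 1, z => by
    rw [orFin, orFin_eq_decide m, Bool.eq_iff_iff]
    simp only [Bool.or_eq_true, decide_eq_true_eq, Fin.exists_fin_succ']

/-- An `m`-fold disjunction costs `m + 1` gates over `B₂`. [cite: Vollmer1999, §1.2] -/
theorem cktSize_orFin : ∀ m : ℕ, CktSize B2 (fun (z : Fin m → Bool) (_ : Unit) => orFin m z) (m + 1)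
  | 0 => (cktSize_const (Fin 0) false).congr fun z u => rfl
  | m + 1 => by
    have hA : CktSize B2 (fun (z : Fin (m + 1) → Bool) =>
        Sum.elim (fun (_ : Unit) => orFin m fun j => z j.castSucc) (fun (_ : Unit) => z (Fin.last m)))
        ((m + 1) + 0) :=
      ((cktSize_orFin m).rewire Fin.castSucc).pair
        ((CktSize.proj B2 fun _ : Unit => Fin.last m).congr fun _ _ => rfl)
    have hB := cktSize_bin (ι := Unit ⊕ Unit) (· || ·) (.inl ()) (.inr ())
    exact ((hA.comp hB).of_le (by omega)).congr fun z u => rfl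

/-- **Table circuits**: membership in an explicit list of `M` strings of length `N` costs
`M(2N+1) + M + 1` gates (one equality test per entry, `cktSize_eqConst`, then an OR chain). [folklore] -/
theorem cktSize_table {N M : ℕ} (ys : Fin M → (Fin N → Bool)) :
    CktSize B2 (fun (z : Fin N → Bool) (_ : Unit) => decide (∃ j, z = ys j))
      (M * (N * 1 + (N + 1)) + (M + 1)) := by
  have h1 := CktSize.pi_const (κ := Fin M) fun j => cktSize_eqConst (ys j)
  rw [Fintype.card_fin] at h1
  refine (h1.comp (cktSize_orFin M)).congr fun z _ => ?_
  show orFin M (fun j => decide (z = ys j)) = decide (∃ j, z = ys j)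
  rw [orFin_eq_decide]
  simp

end Table

/-! ## The PEREBOR LAW in KERNEL, part 2: the per-length circuit = TABLE ∪ PADDED QUERY -/

/-- The table of strings of length `N` with a short witness program is finite. -/
theorem finite_table (U : UniversalMachine) (s : ℕ → ℕ) (γ N : ℕ) :
    {x : List Bool | x.length = N ∧ (∃ (p : List Bool) (t : ℕ), p.length ≤ γ ∧ U.run p t = some x ∧ p.length + Nat.clog 2 t ≤ s (x).length)}.Finite := by
  apply (U.finite_setOf_levinKt_lt (s N + 1)).subset
  rintro x ⟨hN, p, t, -, hrun, hle⟩
  have h := U.levinKt_le_of_run hrun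
  rw [hN] at hle
  have h' : U.levinKt x ≤ ((s N : ℕ) : ℕ∞) := h.trans (by exact_mod_cast hle)
  have h'' : ((s N : ℕ) : ℕ∞) < ((s N + 1 : ℕ) : ℕ∞) := by exact_mod_cast Nat.lt_succ_self (s N)
  exact lt_of_le_of_lt h' h''

/-- Every slice has a circuit of size `univBound N` (Shannon expansion; the small-`N` case). -/
theorem circuitSize_le_univBound (L : Language Bool) (N : ℕ) : L.circuitSize N ≤ univBound N := by
  obtain ⟨C, hC, hsz, hev⟩ := (cktSize_univ_fin N (fun z (_ : Unit) => L.sliceFn N z)).toCircuit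
  exact (circuitSizeOver_le_of_computes C hC (fun z => hev z)).trans hsz

/-- A slice containing every string of its length has a circuit of size `1` (the constant). -/
theorem circuitSize_le_one_of_forall_mem (L : Language Bool) (N : ℕ)
    (h : ∀ x : List Bool, x.length = N → x ∈ L) : L.circuitSize N ≤ 1 := by
  obtain ⟨C, hC, hsz, hev⟩ := (cktSize_const (Fin N) true).toCircuit
  refine (circuitSizeOver_le_of_computes C hC (fun z => ?_)).trans hsz
  rw [hev]
  exact ((Set.mem_iff_boolIndicator _ _).1 (h (List.ofFn z) (List.length_ofFn ..))).symm

/-- KERNEL (the law's construction at one length): for every level `γ`,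
`size(MKtP_U[s] ∩ {0,1}^N) ≤ 2^{γ+1}(2N+2) + 4 + size_W(m)`, `m = padLen (s N) γ N` —
the table of `< 2^{γ+1}` strings OR-ed with ONE copy of a `W_U`-circuit fed the padded query. -/
theorem circuitSize_MKtP_le_of_W (U : UniversalMachine) (s : ℕ → ℕ) {fW : ℕ → ℕ}
    (hW : W U ∈ SIZE fW) (γ N : ℕ) :
    (U.MKtP s).circuitSize N ≤ 2 ^ (γ + 1) * (2 * N + 2) + 4 + fW (padLen (s N) γ N) := by
  classical
  obtain ⟨CW, hCW, hdec⟩ := hW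
  set L := U.MKtP s with hL
  -- the table
  let T : Finset (Fin N → Bool) := Finset.univ.filter fun z => (∃ (p : List Bool) (t : ℕ), p.length ≤ γ ∧ U.run p t = some (List.ofFn z) ∧ p.length + Nat.clog 2 t ≤ s ((List.ofFn z)).length)
  set M := T.card with hM
  let e : T ≃ Fin M := T.equivFin
  let ys : Fin M → (Fin N → Bool) := fun j => (e.symm j).1
  have hys : ∀ z : Fin N → Bool, (∃ j, z = ys j) ↔ (∃ (p : List Bool) (t : ℕ), p.length ≤ γ ∧ U.run p t = some (List.ofFn z) ∧ p.length + Nat.clog 2 t ≤ s ((List.ofFn z)).length) := by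
    intro z
    constructor
    · rintro ⟨j, rfl⟩
      exact (Finset.mem_filter.1 (e.symm j).2).2
    · intro hz
      have hzT : z ∈ T := by simpa [T] using hz
      exact ⟨e ⟨z, hzT⟩, by simp [ys]⟩
  have hT : CktSize B2 (fun (z : Fin N → Bool) (_ : Unit) => decide (∃ j, z = ys j))
      (M * (N * 1 + (N + 1)) + (M + 1)) := Table.cktSize_table ys
  -- the padded query
  set D := CW (padLen (s N) γ N) with hD
  have hDover : D.IsOver B2 := (hCW _).1
  have hDsize : D.size ≤ fW (padLen (s N) γ N) := (hCW _).2
  have hDeval : ∀ u : Fin (padLen (s N) γ N) → Bool, D.eval u = (W U).boolIndicator (List.ofFn u) :=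
    fun u => hdec.eval_eq u
  have hWp : CktSize B2 (fun (z : Fin N → Bool) (_ : Unit) => D.eval (padVec (s N) γ N z)) (2 + D.size) :=
    (cktSize_padVec (s N) γ N).comp (D.cktSize_eval hDover)
  -- OR of the two
  have hor := (hT.pair hWp).comp (cktSize_or (Sum.inl ()) (Sum.inr ()))
  obtain ⟨C, hC, hsz, hev⟩ := hor.toCircuit
  have key : ∀ z : Fin N → Bool, List.ofFn z ∈ L ↔
      (∃ (p : List Bool) (t : ℕ), p.length ≤ γ ∧ U.run p t = some (List.ofFn z) ∧ p.length + Nat.clog 2 t ≤ s ((List.ofFn z)).length) ∨ padQ (s N) γ (List.ofFn z) ∈ W U := fun z =>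
    mem_MKtP_iff_table_or_W U s γ (List.ofFn z) (List.replicate (s N) true)
      (List.replicate (2 ^ (s N - γ - 1)) true) (by simp) (by simp)
  have hcomp : C.Computes (L.sliceFn N) := fun z => by
    rw [hev]
    show (decide (∃ j, z = ys j) || D.eval (padVec (s N) γ N z)) = L.boolIndicator (List.ofFn z)
    rw [hDeval, ofFn_padVec, Bool.eq_iff_iff, Bool.or_eq_true, decide_eq_true_iff, hys z,
      ← Set.mem_iff_boolIndicator, ← Set.mem_iff_boolIndicator]
    exact (key z).symm
  have h1 : L.circuitSize N ≤ M * (N * 1 + (N + 1)) + (M + 1) + (2 + D.size) + 1 :=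
    (circuitSizeOver_le_of_computes C hC hcomp).trans hsz
  -- the table is small
  have hMle : M ≤ 2 ^ (γ + 1) := by
    have hfin := finite_table U s γ N
    have himg : (List.ofFn '' (T : Set (Fin N → Bool))) ⊆ {x : List Bool | x.length = N ∧ (∃ (p : List Bool) (t : ℕ), p.length ≤ γ ∧ U.run p t = some x ∧ p.length + Nat.clog 2 t ≤ s (x).length)} := by
      rintro x ⟨z, hz, rfl⟩
      have hzT : (∃ (p : List Bool) (t : ℕ), p.length ≤ γ ∧ U.run p t = some (List.ofFn z) ∧ p.length + Nat.clog 2 t ≤ s ((List.ofFn z)).length) := by simpa [T] using hz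
      exact ⟨List.length_ofFn .., hzT⟩
    have hinj : Set.InjOn (List.ofFn : (Fin N → Bool) → List Bool) (T : Set (Fin N → Bool)) :=
      fun a _ b _ h => List.ofFn_injective h
    calc M = (T : Set (Fin N → Bool)).ncard := by rw [Set.ncard_coe_finset]
      _ = (List.ofFn '' (T : Set (Fin N → Bool))).ncard := (hinj.ncard_image).symm
      _ ≤ {x : List Bool | x.length = N ∧ (∃ (p : List Bool) (t : ℕ), p.length ≤ γ ∧ U.run p t = some x ∧ p.length + Nat.clog 2 t ≤ s (x).length)}.ncard := Set.ncard_le_ncard himg hfin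
      _ ≤ 2 ^ (γ + 1) := (ncard_table_lt U s γ N).le
  have h2 : M * (2 * N + 2) ≤ 2 ^ (γ + 1) * (2 * N + 2) := Nat.mul_le_mul_right _ hMle
  have h3 : M * (N * 1 + (N + 1)) + (M + 1) + (2 + D.size) + 1 = M * (2 * N + 2) + 4 + D.size := by ring
  rw [h3] at h1
  calc L.circuitSize N ≤ M * (2 * N + 2) + 4 + D.size := h1
    _ ≤ 2 ^ (γ + 1) * (2 * N + 2) + 4 + fW (padLen (s N) γ N) := by
        have := hDsize; linarith



end Summit.PneNP.PneNP.Theorems.RootDecompKtPereborPort
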